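import Mathlib
import Summits.ValiantsHypothesis.ValiantsHypothesis.Theses.FreeSubtorus
import Literature.Computability.AlgebraicComplexity.LRPencilOfMatrix
import Summits.ValiantsHypothesis.ValiantsHypothesis.Theorems.FreeSubtorusOrbitDimensionBoundSlices

/-!
# `FreeSubtorus.OrbitDimensionBound` (crux stmt-ValiantsHypothesis-16133) — ALTERNATIVE line
# `graded-grenet` (strategist, lens: strengthen + model switch): regrading is free, and Grenet is
# optimal among GRADED (= homogeneous-ABP) representations

Crux (rank 2 of route-ValiantsHypothesis-FreeSubtorus), BY NAME:
`Summit.ValiantsHypothesis.ValiantsHypothesis.Theses.FreeSubtorus.OrbitDimensionBound` — for `n ≥ 3` and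
every `m`: if `per_n` has an affine determinantal representation of size `m`, then it has one of the
SAME size that is exactly equivariant under an admissible subtorus `T_Λ` with `r ≤ n/2` relations.

## The line

A size-`m` affine representation `B` of `per_n` is **graded** by integer potentials
`a, b : Fin m → ℤ` if every nonzero constant sits at an entry with `a i + b j = 0` and every variable
at an entry with `a i + b j = 1` (equivalently: the homothety `x ↦ c·x` lifts to the one-parameter
pair `(diag c^{a}, diag c^{-b})`; by von zur Gathen regularity — `constPart B` has rank `m - 1`,
tree `isRegularDetRepr_perPoly` — a graded representation of `per_n` is, after a constant graded gauge,
a HOMOGENEOUS LAYERED ABP with `m - 1` internal nodes, layers = potential classes).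

* **Stub 1 (`stub_gradedAtNoCost`) — regrading is free.**  For `n ≥ 4`: if `per_n` has an affine
  representation of size `m`, it has a GRADED one of size `m` (`dc(per_n) = gdc(per_n)`).  This is a
  CONSEQUENCE of the crux (Disproof §3 / tree `homothetyLifts_of_orbitDimensionBound`: homotheties lie in
  every admissible `T_Λ`; an exact-lift group surjecting onto `𝔾_m` contains a lifting 1-PS, whose
  eigen-gauge grades `B`), hence no stronger than the crux; it isolates the homothety part of
  Landsberg–Ressayre's Question 2.2 ("homogenisation at no cost", Ikenmeyer–Landsberg 2017 §3) as a
  statement with NO Valiant-strength content, attackable by the Białynicki-Birula initial-form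
  dictionary (tree `stub_initialFormAccumulates`: a constant gauge whose formal Leibniz terms have no
  sub-degree-`n` term suffices) and testable on toy polynomials (uniform version: every regular
  affine representation of a form with `codim Sing ≥ 5` regrades at no cost).
* **Stub 2 (`stub_gradedGrenetBound`) — Grenet is optimal among graded representations.**  For
  `n ≥ 4`, every GRADED affine representation of `per_n` has size `≥ 2ⁿ - 1`.  The PROVED sibling is
  `TorusBound` (stmt-5114/4164, two-sided-torus-graded ⇒ `≥ 2ⁿ - 1`); this stub drops the torus to the
  degree grading.  In ABP language: every homogeneous ABP for `per_n` has `≥ 2ⁿ - 2` internal nodes;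
  layer `k` has width `≥ prank_k(per_n)` (fewest products `g·h`, `deg g = k`, summing to `per_n`) and
  the conjectured `prank_k(per_n) = C(n,k)` (Laplace is optimal; `k = 1` provable now: `per_n` lies in
  no ideal of `n - 1` linear forms, by toric degeneration of the subspace + Hall) sums to Grenet's
  count.  FIRST DECIDABLE INSTANCE: `n = 4`, "no homogeneous ABP with 13 internal nodes computes
  `per_4`" (width profiles `(4,5,4)`, `(5,4,4)`, `(4,4,5)` after the `k = 1` lemma) — numerically
  probed by the strategist's kit jobs (ALS over `ℂ`, calibrated at Grenet's `(4,6,4)`), certifiable by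
  computer algebra.  This is where the line DODGES the stuck goal of line `Sketch`: `stub_smallFace` has
  no decidable instance (its hypothesis range `dc(per_n) ≤ m ≤ 2ⁿ - 2` is not known to be inhabited),
  whereas this stub asserts that range is EMPTY in the graded model and is checkable size by size.
* **Composition (`OrbitDimensionBound_of`, sorry-free):** reduce to `n ≥ 4`
  (tree `orbitDimensionBound_of_four_le`); stub 1 turns the given representation into a graded one of
  the same size `m`; stub 2 gives `2ⁿ - 1 ≤ m`; the tree's `concl_of_two_pow_le` (pad Grenet, `r = 0`)
  is the crux's conclusion at `(n, m)`.

Honest label: stub 2 is a STRENGTHENING all the way to Grenet optimality (graded model), summit-strength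
(with the known homogenisation `gdc ≤ (n+1)·dc` it gives an exponential `dc` bound); the bet is shared
with RigidityForcesSymmetry.GrenetLowerBound (stmt-4162, "infinitely often") and
RigidMinimalReps.MinimalRepTorusSymmetric (stmt-5112, eventual `r = 0`), and stubs 1 ∧ 2 imply both of
those items as well as this crux.  Disproof used: §4 (in-place symmetrisation false — stub 1 is
existential in `B`), §3 (homothety necessary condition = stub 1's content), §5 (`r = 0` strengthening ≡
Grenet optimality — this line is §5 factored through the graded model), Negative/FalseWithoutRepHyp
(the representation hypothesis is kept in stub 1).
-/

namespace Summit.ValiantsHypothesis.ValiantsHypothesis.Cruxes.OrbitDimensionBound.GradedGrenet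

open Matrix MvPolynomial Finset
open Literature.Computability.AlgebraicComplexity LRPencil

-- `Summit.ValiantsHypothesis.ValiantsHypothesis.…` is the tree's mandated single-conjunct layout (Sub = Summit).
set_option linter.dupNamespace false

noncomputable section

/-! ## §1 The stub statements as `Prop`s -/

/-- Statement of stub 1 (`stub_gradedAtNoCost`): **regrading is free** — for `n ≥ 4`, a size-`m`
affine representation of `per_n` can be replaced by a GRADED one of the same size (constants only at
entries of potential `0`, variables only at entries of potential `1`).
[cite: LandsbergRessayre2017, §2 Q2.2] [cite: IkenmeyerLandsberg2017, §3] -/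
def Stmt.stub_gradedAtNoCost : Prop :=
  ∀ n : ℕ, 4 ≤ n → ∀ (m : ℕ) (A : Matrix (Fin m) (Fin m) (MvPolynomial (Fin n × Fin n) ℂ)),
    Literature.Computability.AlgebraicComplexity.IsAffineDetRepr
        (Literature.Computability.AlgebraicComplexity.perPoly (Fin n) ℂ) A →
    ∃ (B : Matrix (Fin m) (Fin m) (MvPolynomial (Fin n × Fin n) ℂ)) (a b : Fin m → ℤ),
      Literature.Computability.AlgebraicComplexity.IsAffineDetRepr
          (Literature.Computability.AlgebraicComplexity.perPoly (Fin n) ℂ) B ∧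
      (∀ i j, Literature.Computability.AlgebraicComplexity.constPart B i j ≠ 0 → a i + b j = 0) ∧
      (∀ i j (p : Fin n × Fin n),
        Literature.Computability.AlgebraicComplexity.LRPencil.coeffMat B p i j ≠ 0 → a i + b j = 1)

/-- Statement of stub 2 (`stub_gradedGrenetBound`): **Grenet is optimal among graded representations**
— for `n ≥ 4`, every graded affine determinantal representation of `per_n` has size `≥ 2ⁿ - 1`
(the two-sided-torus-graded case is the PROVED `TorusBound`). [cite: Grenet2011, Thm. 1]
[cite: LandsbergRessayre2017, Thm. 2.8] -/
def Stmt.stub_gradedGrenetBound : Prop :=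
  ∀ n : ℕ, 4 ≤ n → ∀ (m : ℕ) (B : Matrix (Fin m) (Fin m) (MvPolynomial (Fin n × Fin n) ℂ)) (a b : Fin m → ℤ),
    Literature.Computability.AlgebraicComplexity.IsAffineDetRepr
        (Literature.Computability.AlgebraicComplexity.perPoly (Fin n) ℂ) B →
    (∀ i j, Literature.Computability.AlgebraicComplexity.constPart B i j ≠ 0 → a i + b j = 0) →
    (∀ i j (p : Fin n × Fin n),
      Literature.Computability.AlgebraicComplexity.LRPencil.coeffMat B p i j ≠ 0 → a i + b j = 1) →
    2 ^ n - 1 ≤ m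

/-! ## §2 The registered stubs (the ONLY sorries of this file) -/

/-- **Registered stub 1 = `Stmt.stub_gradedAtNoCost`** (regrading is free; OPEN, a consequence of the
crux, no Valiant-strength content). [cite: LandsbergRessayre2017, §2 Q2.2] -/
theorem stub_gradedAtNoCost :
    ∀ n : ℕ, 4 ≤ n → ∀ (m : ℕ) (A : Matrix (Fin m) (Fin m) (MvPolynomial (Fin n × Fin n) ℂ)),
    Literature.Computability.AlgebraicComplexity.IsAffineDetRepr
        (Literature.Computability.AlgebraicComplexity.perPoly (Fin n) ℂ) A →
    ∃ (B : Matrix (Fin m) (Fin m) (MvPolynomial (Fin n × Fin n) ℂ)) (a b : Fin m → ℤ),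
      Literature.Computability.AlgebraicComplexity.IsAffineDetRepr
          (Literature.Computability.AlgebraicComplexity.perPoly (Fin n) ℂ) B ∧
      (∀ i j, Literature.Computability.AlgebraicComplexity.constPart B i j ≠ 0 → a i + b j = 0) ∧
      (∀ i j (p : Fin n × Fin n),
        Literature.Computability.AlgebraicComplexity.LRPencil.coeffMat B p i j ≠ 0 → a i + b j = 1) := by
  sorry

/-- **Registered stub 2 = `Stmt.stub_gradedGrenetBound`** (Grenet optimal among graded
representations; OPEN, summit-strength; first decidable instance `n = 4`, `m = 14`).
[cite: Grenet2011, Thm. 1] [cite: LandsbergRessayre2017, Thm. 2.8] -/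
theorem stub_gradedGrenetBound :
    ∀ n : ℕ, 4 ≤ n → ∀ (m : ℕ) (B : Matrix (Fin m) (Fin m) (MvPolynomial (Fin n × Fin n) ℂ)) (a b : Fin m → ℤ),
    Literature.Computability.AlgebraicComplexity.IsAffineDetRepr
        (Literature.Computability.AlgebraicComplexity.perPoly (Fin n) ℂ) B →
    (∀ i j, Literature.Computability.AlgebraicComplexity.constPart B i j ≠ 0 → a i + b j = 0) →
    (∀ i j (p : Fin n × Fin n),
      Literature.Computability.AlgebraicComplexity.LRPencil.coeffMat B p i j ≠ 0 → a i + b j = 1) →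
    2 ^ n - 1 ≤ m := by
  sorry

/-! ## §3 The composition (kernel-checked, sorry-free) -/

/-- **The crux from the two stubs** (real proof): reduce to `n ≥ 4` (tree
`orbitDimensionBound_of_four_le`, the slice `n = 3` is a tree theorem); stub 1 regrades the given
representation at the same size; stub 2 bounds that size below by `2ⁿ - 1`; the tree's
`concl_of_two_pow_le` (padded Grenet, `r = 0`) is the crux's conclusion.
[cite: Grenet2011, Thm. 1] [cite: AlperBogartVelasco2017, Cor. 1.4] -/
theorem OrbitDimensionBound_of :
    Stmt.stub_gradedAtNoCost → Stmt.stub_gradedGrenetBound →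
      Summit.ValiantsHypothesis.ValiantsHypothesis.Theses.FreeSubtorus.OrbitDimensionBound := by
  intro h₁ h₂
  refine Summit.ValiantsHypothesis.ValiantsHypothesis.Theorems.FreeSubtorusOrbitDimensionBound.orbitDimensionBound_of_four_le
    (fun n hn m A hA => ?_)
  obtain ⟨B, a, b, hB, h0, h1⟩ := h₁ n hn m A hA
  have hm : 2 ^ n - 1 ≤ m := h₂ n hn m B a b hB h0 h1
  exact Summit.ValiantsHypothesis.ValiantsHypothesis.Theorems.FreeSubtorusOrbitDimensionBound.concl_of_two_pow_le
    (by omega) hm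

/-- **THE SKELETON: the crux BY NAME, modulo exactly the two registered stubs.**
[cite: LandsbergRessayre2017, §2] -/
theorem OrbitDimensionBound_proof :
    Summit.ValiantsHypothesis.ValiantsHypothesis.Theses.FreeSubtorus.OrbitDimensionBound :=
  OrbitDimensionBound_of stub_gradedAtNoCost stub_gradedGrenetBound

end

end Summit.ValiantsHypothesis.ValiantsHypothesis.Cruxes.OrbitDimensionBound.GradedGrenet
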